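import Mathlib

/-!
# `GrenetZeon.DualUnipotentThreeHalves` (stmt-ValiantsHypothesis-24318), R2 heavy-top instrument — the FIRST-ORDER (tangent) IDENTITY
# of a nilpotent pencil: `(A + xB)^p = 0` for all `x` ⇒ `Σ_{i+j=p−1} A^i B A^j = 0`, any size, any `p`

Experiment cell «val-heavytop-census» (D-0160), engine seat val-htc-eng-2 g3 (kernel-only lane).  This is the general form of the
tool (T1) of the cell's hand proofs (eng-1 `NOTE-iota4.md`; typed for `p = 3, 4` only as ✓ `firstOrder_of_cube`,
✓ `firstOrder_of_pow_four` in `…HeavyTopIotaFourConstraints`), and §0 («the envelope `T`») of the lead's pencil proof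
`lead-g2/Q1-PROOF.md` behind Q1 «ι(7) ≤ 19» (kernel port P-Q1, director-valiant R336 (5)): for a linear space `V` of matrices
with `M^p = 0` on `V` and `A, B ∈ V`, the `x¹`-coefficient of `(A + xB)^p` is the linear constraint
`L_A(B) := Σ_{i=0}^{p−1} A^i B A^{p−1−i} = 0` («`V ⊆ T_A`», the tangent cut at `A`; for `A = J_{s−1} ⊕ 0`, `p = s − 1` it is
the space `T` of Q1-PROOF §0, for `A = J_m` it is MacDonald–MacDougall–Sweet's / the ROADMAP's `V ⊆ A + C(A)^⊥`).

* `coeff_zero_C_add_C_mul_X_pow`, `coeff_one_C_add_C_mul_X_pow` — in `S[X]` for ANY semiring `S` (here `S = M_n(ℂ)`):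
  `[(C a + C b·X)^p]_0 = a^p`, `[(C a + C b·X)^p]_1 = Σ_{i<p} a^i b a^{p−1−i}`;
* ★ `firstOrder_eq_zero_of_forall_pow_eq_zero` — `(∀ x : ℂ, (A + x • B)^p = 0) → Σ_{i<p} A^i B A^{p−1−i} = 0`
  (via `matPolyEquiv`: the matrix of polynomials `Q(X)` with `Q(x) = A + xB` has `Q^p = 0` because every entry of `Q^p` has
  infinitely many roots, and the `X¹`-coefficient of `Q^p` is the first-order term);
* `firstOrder_eq_zero_of_mem` — the same for `A, B` in a linear space `V ≤ M_n(ℂ)` on which `M^p = 0`.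

Honest framing: a bookkeeping lemma for the instrument's kernel ports (P-Q1 §0, Thm C / R4′ tangent cuts); nothing here proves or
refutes `HeavyTopLaw`/`HeavyTopSlowLaw`, 24318, S3 or 8062; `VP ≠ VNP` is NOT proved.  No definitions.  [folklore; this seat]
-/

noncomputable section

-- single-conjunct layout: Sub = Summit, duplicated namespace component intended
set_option linter.dupNamespace false

namespace Summit.ValiantsHypothesis.ValiantsHypothesis.Theorems.GrenetZeon.HeavyTopPencilFirstOrder

open Matrix Polynomial

/-! ## Coefficients `0` and `1` of `(C a + C b·X)^p` over an arbitrary semiring -/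

/-- `[(C a + C b·X)^p]_0 = a^p` and `[(C a + C b·X)^p]_1 = Σ_{i<p} a^i b a^{p−1−i}` (any semiring; joint induction). -/
theorem coeff_zero_one_C_add_C_mul_X_pow {S : Type*} [Semiring S] (a b : S) (p : ℕ) :
    ((C a + C b * X) ^ p).coeff 0 = a ^ p ∧
      ((C a + C b * X) ^ p).coeff 1 = ∑ i ∈ Finset.range p, a ^ i * b * a ^ (p - 1 - i) := by
  have g0 : (C a + C b * X).coeff 0 = a := by simp
  have g1 : (C a + C b * X).coeff 1 = b := by simp
  induction p with
  | zero => simp [Polynomial.coeff_one]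
  | succ p ih =>
    obtain ⟨ih0, ih1⟩ := ih
    constructor
    · rw [pow_succ, Polynomial.coeff_mul, Finset.Nat.antidiagonal_zero, Finset.sum_singleton, ih0, g0, pow_succ]
    · rw [pow_succ, Polynomial.coeff_mul, Finset.Nat.sum_antidiagonal_succ, Finset.Nat.antidiagonal_zero,
        Finset.sum_singleton, zero_add, ih0, ih1, g0, g1, Finset.sum_range_succ, Finset.sum_mul]
      have e1 : ∀ i ∈ Finset.range p, a ^ i * b * a ^ (p - 1 - i) * a = a ^ i * b * a ^ (p + 1 - 1 - i) := by
        intro i hi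
        rw [Finset.mem_range] at hi
        rw [mul_assoc, ← pow_succ, show p - 1 - i + 1 = p + 1 - 1 - i by omega]
      rw [Finset.sum_congr rfl e1, show p + 1 - 1 - p = 0 by omega, pow_zero, mul_one, add_comm]

/-- `[(C a + C b·X)^p]_0 = a^p`. -/
theorem coeff_zero_C_add_C_mul_X_pow {S : Type*} [Semiring S] (a b : S) (p : ℕ) :
    ((C a + C b * X) ^ p).coeff 0 = a ^ p :=
  (coeff_zero_one_C_add_C_mul_X_pow a b p).1

/-- `[(C a + C b·X)^p]_1 = Σ_{i<p} a^i b a^{p−1−i}` — the first-order term of the pencil `a + x b`. -/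
theorem coeff_one_C_add_C_mul_X_pow {S : Type*} [Semiring S] (a b : S) (p : ℕ) :
    ((C a + C b * X) ^ p).coeff 1 = ∑ i ∈ Finset.range p, a ^ i * b * a ^ (p - 1 - i) :=
  (coeff_zero_one_C_add_C_mul_X_pow a b p).2

/-! ## The first-order identity of a nilpotent pencil -/

/-- ★ **First-order identity.**  If `(A + xB)^p = 0` for every `x : ℂ`, then `Σ_{i<p} A^i B A^{p−1−i} = 0`
(the `x¹`-coefficient of the polynomial identity `(A + xB)^p ≡ 0`). [folklore; (T1) of NOTE-iota4, §0 of Q1-PROOF] -/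
theorem firstOrder_eq_zero_of_forall_pow_eq_zero {n : Type*} [Fintype n] [DecidableEq n]
    (A B : Matrix n n ℂ) (p : ℕ) (h : ∀ x : ℂ, (A + x • B) ^ p = 0) :
    ∑ i ∈ Finset.range p, A ^ i * B * A ^ (p - 1 - i) = 0 := by
  classical
  -- the pencil as a polynomial with matrix coefficients, and as a matrix with polynomial entries
  set P : (Matrix n n ℂ)[X] := C A + C B * X with hP
  set Q : Matrix n n ℂ[X] := matPolyEquiv.symm P with hQ
  have hQx : ∀ x : ℂ, Q.map (Polynomial.eval x) = A + x • B := by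
    intro x
    rw [hQ, matPolyEquiv_symm_map_eval, hP, Polynomial.eval_add, Polynomial.eval_C, Polynomial.eval_mul_X,
      Polynomial.eval_C]
    ext i j
    simp [Matrix.scalar_apply, Matrix.mul_diagonal, mul_comm]
  -- `Q^p` evaluates to `(A + xB)^p = 0` at every `x`
  have hQp : ∀ x : ℂ, (Q ^ p).map (Polynomial.eval x) = 0 := by
    intro x
    have hm : (Q ^ p).map (Polynomial.eval x) = (Q.map (Polynomial.eval x)) ^ p := by
      change (Polynomial.evalRingHom x).mapMatrix (Q ^ p) = ((Polynomial.evalRingHom x).mapMatrix Q) ^ p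
      exact map_pow _ _ _
    rw [hm, hQx, h x]
  -- hence `Q^p = 0`: every entry has infinitely many roots
  have hQ0 : Q ^ p = 0 := by
    refine Matrix.ext fun a b => ?_
    have hroots : ∀ x : ℂ, ((Q ^ p) a b).IsRoot x := by
      intro x
      have := congr_fun (congr_fun (hQp x) a) b
      simp only [Polynomial.IsRoot]; simpa using this
    exact Polynomial.eq_zero_of_infinite_isRoot _ (Set.infinite_univ.mono fun x _ => hroots x)
  -- transport to `P^p = 0` and read off the `X¹`-coefficient
  have hPp : P ^ p = 0 := by
    have e := congrArg matPolyEquiv hQ0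
    rwa [map_pow, hQ, AlgEquiv.apply_symm_apply, map_zero] at e
  have hc := congrArg (fun f : (Matrix n n ℂ)[X] => f.coeff 1) hPp
  simp only [Polynomial.coeff_zero] at hc
  rwa [hP, coeff_one_C_add_C_mul_X_pow] at hc

/-- **First-order identity in a nilpotent linear space.**  If every member of the linear space `V ≤ M_n(ℂ)` satisfies `M^p = 0`
and `A, B ∈ V`, then `Σ_{i<p} A^i B A^{p−1−i} = 0` («`V ⊆ T_A`», the tangent cut at `A`). [folklore; (T1) / Q1-PROOF §0] -/
theorem firstOrder_eq_zero_of_mem {n : Type*} [Fintype n] [DecidableEq n] (V : Submodule ℂ (Matrix n n ℂ)) (p : ℕ)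
    (hV : ∀ M ∈ V, M ^ p = 0) {A B : Matrix n n ℂ} (hA : A ∈ V) (hB : B ∈ V) :
    ∑ i ∈ Finset.range p, A ^ i * B * A ^ (p - 1 - i) = 0 :=
  firstOrder_eq_zero_of_forall_pow_eq_zero A B p fun x => hV _ (V.add_mem hA (V.smul_mem x hB))

end Summit.ValiantsHypothesis.ValiantsHypothesis.Theorems.GrenetZeon.HeavyTopPencilFirstOrder

end
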